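import Summits.Ventures.QEC.Census.CNFEncodeSound
import HarnessLib

/-!
# Covering lemmas for cubed fibre certificates (CDX, engine seat qec-cdx-eng-1)

A fibre instance of the CDX lane is `SolvesAny n rows [u] w` (`Summit.Ventures.QEC.Census.CNFEncode`): all `rows` have even
parity, the first generator group `u` has odd parity, weight `≤ w`.  When a single LRAT refutation is too large for one file the
instance is CUBED on the columns of a group `g` whose parity is forced odd (`g = u`, or a link row `u ++ g ∈ rows`): leaf `c ∈ g`
is the enc-v1 CNF with the coordinate unit clause `[(c, true)]` appended, refuted by the kernel and turned into
`∀ a, (unit holds) → ¬ SolvesAny …` by `cnfEncodeAny_append_unsat_imp`.  `fibreEmpty_of_groupCover` assembles the leaves: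
an odd-parity group has a true coordinate, which selects the leaf.  Pure logic over `lparity`; no statement of the cell changes.
-/

namespace Summit.Ventures.QEC.CircuitDistance

open Std.Sat Summit.Ventures.QEC.Census.CNFEncode

/-- A list of odd parity under `a` has an entry where `a` is true. -/
theorem exists_true_of_lparity (a : ℕ → Bool) : ∀ l : List ℕ, lparity a l = true → ∃ x ∈ l, a x = true
  | [], h => by simp [lparity] at h
  | x :: xs, h => by
    by_cases hx : a x = true
    · exact ⟨x, by simp, hx⟩
    · have h' : lparity a xs = true := by
        simp only [lparity] at h
        revert h; cases ha : a x <;> simp_all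
      obtain ⟨y, hy, hay⟩ := exists_true_of_lparity a xs h'
      exact ⟨y, by simp [hy], hay⟩

/-- If `u` is odd and the link row `u ++ g` is even then `g` is odd. -/
theorem lparity_true_of_link (a : ℕ → Bool) (u g : List ℕ) (hu : lparity a u = true)
    (hlink : lparity a (u ++ g) = false) : lparity a g = true := by
  rw [lparity_append, hu] at hlink
  revert hlink; cases lparity a g <;> simp

/-- **Group-cube cover**: if the parity of the group `g` is forced odd (it is `u`, or the link row `u ++ g` is one of the even
`rows`) and for every column `c ∈ g` the leaf with the unit clause `x_c` is infeasible, then the fibre instance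
`SolvesAny n rows [u] w` has no solution. -/
theorem fibreEmpty_of_groupCover {n : ℕ} {rows : List (List ℕ)} {u : List ℕ} {w : ℕ} (g : List ℕ)
    (hg : g = u ∨ (u ++ g) ∈ rows)
    (hleaves : ∀ c ∈ g, ∀ a : ℕ → Bool,
      (∀ cl ∈ ([[(c, true)]] : List (CNF.Clause Nat)), CNF.Clause.eval a cl = true) → ¬ SolvesAny n rows [u] w a) :
    ¬ ∃ a, SolvesAny n rows [u] w a := by
  rintro ⟨a, ha⟩
  obtain ⟨hrows, ⟨u', hu', hodd⟩, -⟩ := id ha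
  rw [List.mem_singleton] at hu'
  subst hu'
  have hg' : lparity a g = true := by
    rcases hg with rfl | hmem
    · exact hodd
    · exact lparity_true_of_link a _ g hodd (hrows _ hmem)
  obtain ⟨c, hc, hac⟩ := exists_true_of_lparity a g hg'
  refine hleaves c hc a ?_ ha
  intro cl hcl
  rw [List.mem_singleton] at hcl
  subst hcl
  simp [CNF.Clause.eval, hac]

end Summit.Ventures.QEC.CircuitDistance
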